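import Literature.AlgebraicGeometry.Frobenioids.PrimaryStepsTransport
import Literature.AlgebraicGeometry.Frobenioids.BiratUnitsDiv
import HarnessLib

/-!
# Frobenioids I, Theorem 4.2 (ii): functoriality of `Ψ^Prime` with respect to pre-steps

Mochizuki, *The geometry of Frobenioids I: the general theory*, Kyushu J. Math. **62** (2008)
293–400, §4, Theorem 4.2 (ii), kurims text p. 77 (statement) and p. 80 l. 44 – p. 81 l. 4 (proof)
[cite: MochizukiFrdI2008, Thm. 4.2 (ii) p.80]:

  "In the case of a pre-step `B_i → A_i` [where `i = 1, 2`], the desired functoriality follows by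
  considering a commutative diagram `B'_i → B_i`, `C'_i → C_i`, `A'_i → A_i` — where all of the
  morphisms are pre-steps; all of the horizontal morphisms, as well as the vertical morphisms and
  composite morphisms of the upper square, are either isomorphisms or primary steps; either the vertical
  morphisms of the lower square are isomorphisms, or the lower square is a cartesian diagram as in
  Proposition 4.1, (iii)."

PROVED here (sub-node `FrdI:Thm4.2(ii)/T42-L10 PsiPrimeFunctorialPreStep` of
`plan/L1/SUBDAG-FrdI-Thm42-Thm49.md`, holder abc-iut-L1-t14; this piece abc-iut-w4-d090; the
Frobenius-type twin `T42-L09` is abc-iut-L1-t2's `PrimesEquivFrobeniusType.lean`, whose shape we follow).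
For Frobenioids `C_i → F_{Φ_i}` of perfect and isotropic type with `Φ_i` perf-factorial, an equivalence
`Ψ : C₁ ⥲ C₂` such that `Ψ`, `Ψ⁻¹` preserve pre-steps (Thm. 3.4 (ii)) and `Ψ` preserves primary pre-steps
(Thm. 4.2 (i)) — HYPOTHESES by name, as in `PrimaryStepsTransport.lean` —, a family
`e_A : Prime(Φ₁(A)) ≃ Prime(Φ₂(Ψ A))` with the characteristic property of `existsUnique_primesEquiv` (the
prime of `x_ε` goes to the prime of `x_{Ψ ε}` for every primary pre-step `ε` into `A`), and a PRE-STEP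
`γ : A → A'`, primes `𝔭 ⊆ Φ₁(A)`, `𝔭' ⊆ Φ₁(A')` that correspond under `Φ₁(Base γ)` are carried by `e` to
primes that correspond under `Φ₂(Base (Ψ γ))` (`primesEquiv_naturality_preStep_mem`; this is the body of
the slot `FrdI.T42.PsiPrimeFunctorialPreStep`, p412083).

The argument, split exactly as in print into the "lower square" (co-primary case) and the "upper
square" (same-prime case), with the pre-step `γ` first written as `γ = g ≫ ζ` (`ζ` the `𝔭'`-component of
`x_γ`, Def. 1.3 (iii)(d) and the primary splitting of a perf-factorial monoid, Def. 2.4 (i)(c)(d)):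

* co-primary case (`primes_compat_preStep_of_forall_not_dvd`): if no element of `𝔭'` divides `x_γ`, a
  `𝔭'`-primary step `ε` into `A'` and `γ` are co-primary, so Prop. 4.1 (iii) (`exists_coprimary_square`)
  gives a cartesian square of pre-steps `ε' : U → E`, `ι' : U → A` with `x_{ι'} = Φ₁(Base γ)(x_ε) ∈ 𝔭`
  (`ι'` primary); co-primality is categorical (`coprimary_map_iff`), so `Ψ ε`, `Ψ γ` are co-primary and
  Prop. 4.1 (iii) IN `C₂` gives a cartesian square `ε₂', ι₂'` with `x_{ι₂'} = Φ₂(Base Ψγ)(x_{Ψε})`; its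
  universal property applied to the image square `(Ψ ε', Ψ ι')` yields a pre-step `u` with
  `u ≫ ι₂' = Ψ ι'`, whence `x_{ι₂'} ≤ x_{Ψ ι'}`; a non-trivial divisor of a primary element lies in its
  prime (§0), so `x_{ι₂'}` lies in the prime `e_A 𝔭` of `x_{Ψ ι'}`;
* same-prime case (`primes_compat_preStep_of_mem`): if `γ` is itself `𝔭'`-primary, then for a
  `𝔭`-primary step `ε₀` into `A` the composite `ε₀ ≫ γ` is a `𝔭'`-primary step into `A'`
  (`x_{ε₀ ≫ γ} = x_γ · γ_*(x_{ε₀})`, both factors in `𝔭'`), and `γ_*(x_{Ψ ε₀})` is a non-trivial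
  divisor of the primary `x_{Ψ(ε₀ ≫ γ)} ∈ e_{A'} 𝔭'`;
* assembly (`primesEquiv_naturality_preStep_mem`): split `x_γ = c · r` at `𝔭'`
  (`exists_split_at_prime`), factor `γ = g ≫ ζ` with `x_ζ = c` (Def. 1.3 (iii)(d): `iii_d_over_surj`,
  `iii_d_over_full`), apply the two cases to `g` and `ζ` and compose.
The functoriality on all of `C^{bs-iso}` (Prop. 1.7 (ii) + abc-iut-L1-t2's Frobenius-type case) is the
companion file `PrimesEquivBaseIso.lean`.

Composition is diagrammatic; monoids are multiplicative (`x_ψ := (ψ^*)⁻¹ Div ψ` is `invDiv F ψ _`).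
No new definitions; no statement of the paper is strengthened.
-/

namespace Literature.AlgebraicGeometry.Frobenioids

open CategoryTheory Opposite

/-! ### Monoid lemmas (§0 p. 12, Def. 2.4 (i)): primes, divisors, the splitting at a prime -/

section Monoid

universe uM

variable {M : Type uM} [CommMonoid M]

/-- A non-trivial divisor of an element of the prime `𝔭` lies in `𝔭` (a non-trivial `c ≼ p` below a
primary `p` is primary and `≼`-equivalent to `p`, §0 p. 12). [cite: MochizukiFrdI2008, §0 p.12] -/
theorem Primes.mem_carrier_of_dvd (𝔭 : Primes M) {p c : M} (hp : p ∈ 𝔭.carrier) (hc : c ≠ 1)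
    (hcp : c ∣ p) : c ∈ 𝔭.carrier :=
  𝔭.mem_carrier_of_precsim hp hc (Precsim.of_dvd hcp)

/-- In a sharp monoid the product of two elements of a prime `𝔭` lies in `𝔭` ("closed under addition"
for the `≼`-class of a primary element: `a · b ≼ a` as `b ≼ a`). [cite: MochizukiFrdI2008, §0 p.12] -/
theorem Primes.mul_mem_carrier (hM : IsSharp M) (𝔭 : Primes M) {a b : M} (ha : a ∈ 𝔭.carrier)
    (hb : b ∈ 𝔭.carrier) : a * b ∈ 𝔭.carrier := by
  obtain ⟨n, hn, c, hc⟩ := 𝔭.precsim_of_mem_carrier hb ha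
  have hab : a * b ≼ a := ⟨n + 1, Nat.succ_pos n, c, by rw [pow_succ', hc, mul_assoc]⟩
  refine 𝔭.mem_carrier_of_precsim ha (fun h => ?_) hab
  exact ha.1.1 (hM.eq_one_of_isUnit a (IsUnit.of_mul_eq_one b h))

/-- Transport of prime membership along an isomorphism of monoids: if `e` carries SOME element of `𝔭`
into `𝔮`, it carries EVERY element of `𝔭` into `𝔮` (the bijection `Prime(e)`; §0 p. 12).
[cite: MochizukiFrdI2008, §0 p.12] -/
theorem Primes.map_mem_carrier_of_mem {N : Type uM} [CommMonoid N] (e : M ≃* N) {𝔭 : Primes M}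
    {𝔮 : Primes N} {p p' : M} (hp : p ∈ 𝔭.carrier) (hq : e p ∈ 𝔮.carrier) (hp' : p' ∈ 𝔭.carrier) :
    e p' ∈ 𝔮.carrier := by
  refine 𝔮.mem_carrier_of_precsim hq (fun h => hp'.1.1 ?_) (Precsim.map e.toMonoidHom
    (𝔭.precsim_of_mem_carrier hp' hp))
  exact e.injective (by rw [h, map_one])

/-- **The splitting at a prime** (Def. 2.4 (i)(c)(d), "the primary factorizations", pp. 76–77) in a
perfect perf-factorial monoid `M` (through `M ⥲ M^pf`): every `y` is `c · r` with `c = 0` or `c ∈ 𝔭`,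
and `r` divisible by no element of `𝔭`. [cite: MochizukiFrdI2008, Def. 2.4 (i) p.47] -/
theorem IsPerfFactorial.exists_split_at_prime (h : IsPerfFactorial M) (hperf : IsPerfect M) (y : M)
    (𝔭 : Primes M) :
    ∃ c r : M, c * r = y ∧ (c = 1 ∨ c ∈ 𝔭.carrier) ∧ ∀ d ∈ 𝔭.carrier, ¬ d ∣ r := by
  classical
  have hM : IsSharp M := h.isDivisorial.isSharp
  have hbij := isPerfect_iff_bijective_of.mp hperf
  obtain ⟨⟨p, hpP⟩, hp𝔭'⟩ := Quotient.exists_rep 𝔭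
  have hp : p ∈ 𝔭.carrier := ⟨hpP, hp𝔭'⟩
  have hpprim : IsPrimary (Perfection.of M p) := (Perfection.isPrimary_of_iff hM).mpr hp.1
  let 𝔮 : Primes (Perfection M) := Quotient.mk _ ⟨Perfection.of M p, hpprim⟩
  have hp𝔮 : Perfection.of M p ∈ 𝔮.carrier := mem_carrier_mk_of_isPrimary hpprim
  -- membership of `𝔭` is carried into `𝔮`
  have hmem : ∀ d ∈ 𝔭.carrier, Perfection.of M d ∈ 𝔮.carrier := fun d hd =>
    𝔮.mem_carrier_of_precsim hp𝔮 (fun e => hd.1.1 (hbij.1 (by rw [e, map_one])))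
      (Precsim.map (Perfection.of M) (𝔭.precsim_of_mem_carrier hd hp))
  obtain ⟨y₁, y₂, x₁, hy, hy₁, hy₂⟩ := h.exists_split (Perfection.of M y) 𝔮
  obtain ⟨c, rfl⟩ := hbij.2 y₁
  obtain ⟨r, rfl⟩ := hbij.2 y₂
  refine ⟨c, r, hbij.1 (by rw [map_mul, hy]), ?_, fun d hd hdr => ?_⟩
  · by_cases hc : c = 1
    · exact Or.inl hc
    · refine Or.inr (𝔭.mem_carrier_of_precsim hp hc ?_)
      exact Perfection.of_precsim_of_iff.mp (h.precsim_of_factorMap_eq_mulSingle hp𝔮 x₁ hy₁)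
  · exact h.not_dvd_of_factorMap_apply_eq_one (hmem d hd) hy₂ (map_dvd (Perfection.of M) hdr)

end Monoid

namespace PreFrobenioid

universe w v v' u u' w₂ v₂ v₂' u₂ u₂'

variable {D : Type u} [Category.{v} D] {Φ : Dᵒᵖ ⥤ CommMonCat.{w}}
  {C : Type u'} [Category.{v'} C] {F : C ⥤ ElemFrobenioid Φ}

/-! ### One Frobenioid: `x_ψ` along composites and along the square of Prop. 4.1 (iii) -/

/-- `x_{a ≫ δ} = x_δ · δ_*(x_a)` for pre-steps `a : W → Y`, `δ : Y → A` (Remark 1.1.1; `δ_*` = the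
inverse of `Base(δ)^*`). [cite: MochizukiFrdI2008, Rem. 1.1.1 p.21] -/
theorem invDiv_comp_eq_mul {W Y A : C} (a : W ⟶ Y) (δ : Y ⟶ A) (ha : IsBaseIso F a)
    (hδ : IsPreStep F δ) (h : IsBaseIso F (a ≫ δ)) :
    haveI : IsIso (Base F δ) := hδ.2
    invDiv F (a ≫ δ) h = invDiv F δ hδ.2 * pull Φ (inv (Base F δ)) (invDiv F a ha) := by
  haveI : IsIso (Base F δ) := hδ.2
  haveI : IsIso (Base F (a ≫ δ)) := h
  apply pull_injective_of_isIso Φ (Base F (a ≫ δ))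
  rw [pull_invDiv, div_comp_of_isLinear a hδ.1, map_mul, base_comp, pull_comp, pull_comp, pull_invDiv,
    ← pull_comp Φ (Base F δ) (inv (Base F δ)), IsIso.hom_inv_id, pull_id, pull_invDiv]

/-- Pull-back along an isomorphism of `D` detects `1`. [cite: MochizukiFrdI2008, §0 p.12] -/
theorem pull_ne_one_of_ne_one {X Y : D} (g : X ⟶ Y) [IsIso g] {y : Φ.obj (op Y)} (hy : y ≠ 1) :
    pull Φ g y ≠ 1 := fun h => hy (by
  have := congrArg (pull Φ (inv g)) h
  rwa [← pull_comp, IsIso.inv_hom_id, pull_id, map_one] at this)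

/-- In a commutative square of pre-steps `ε' ≫ ε = ι' ≫ γ` with the divisor identity of Prop. 4.1 (iii)
("`ι_* ι'_*(Div ι') = ε_*(Div ε)`", rendered through `Base(-)^*`), `x_{ι'} = Φ(Base γ)(x_ε)`.
[cite: MochizukiFrdI2008, Prop. 4.1 (iii) p.75] -/
theorem invDiv_eq_pull_of_square {U E A A' : C} {ε : E ⟶ A'} {γ : A ⟶ A'} {ι' : U ⟶ A}
    (hε : IsBaseIso F ε) (hι' : IsBaseIso F ι')
    (hdiv : ∀ yε : Φ.obj (op (baseObj F A')), pull Φ (Base F ε) yε = Div F ε →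
      pull Φ (Base F (ι' ≫ γ)) yε = Div F ι') :
    invDiv F ι' hι' = pull Φ (Base F γ) (invDiv F ε hε) := by
  haveI : IsIso (Base F ι') := hι'
  have h := hdiv (invDiv F ε hε) (pull_invDiv ε hε)
  apply pull_injective_of_isIso Φ (Base F ι')
  rw [pull_invDiv, ← h, base_comp, pull_comp]

/-! ### Two Frobenioids -/

variable {D₂ : Type u₂} [Category.{v₂} D₂] {Φ₂ : D₂ᵒᵖ ⥤ CommMonCat.{w₂}}
  {C₂ : Type u₂'} [Category.{v₂'} C₂] {F₂ : C₂ ⥤ ElemFrobenioid Φ₂} (Ψ : C ≌ C₂)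

set_option backward.isDefEq.respectTransparency false in
/-- **The co-primary case** ("the lower square is a cartesian diagram as in Proposition 4.1, (iii)",
p. 81 l. 1–2): for a pre-step `γ : A → A'` such that NO element of `𝔭'` divides `x_γ`, and primes
`𝔭 ∋ Φ₁(Base γ)(p')`, `p' ∈ 𝔭'`, there is `q' ∈ e_{A'} 𝔭'` with `Φ₂(Base Ψγ)(q') ∈ e_A 𝔭`.
[cite: MochizukiFrdI2008, Thm. 4.2 (ii) p.81] -/
theorem primes_compat_preStep_of_forall_not_dvd (hF : IsFrobenioid F) (hF₂ : IsFrobenioid F₂)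
    (hperf : IsOfPerfectType F) (hperf₂ : IsOfPerfectType F₂) (histr : IsOfIsotropicType F)
    (histr₂ : IsOfIsotropicType F₂) (hpf : Objectwise (fun M _ => IsPerfFactorial M) Φ)
    (hpf₂ : Objectwise (fun M _ => IsPerfFactorial M) Φ₂)
    (hpre : ∀ ⦃X Y : C⦄ (φ : X ⟶ Y), IsPreStep F φ → IsPreStep F₂ (Ψ.functor.map φ))
    (hpre' : ∀ ⦃X Y : C₂⦄ (φ : X ⟶ Y), IsPreStep F₂ φ → IsPreStep F (Ψ.inverse.map φ))
    (e : ∀ A : C, Primes (Φ.obj (op (baseObj F A))) ≃ Primes (Φ₂.obj (op (baseObj F₂ (Ψ.functor.obj A)))))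
    (he : ∀ (A : C) ⦃E : C⦄ (ε : E ⟶ A) (hε : IsPrimaryPreStep F ε) (𝔭 : Primes (Φ.obj (op (baseObj F A)))),
      invDiv F ε hε.1.2 ∈ 𝔭.carrier → ∀ h₂ : IsBaseIso F₂ (Ψ.functor.map ε),
        invDiv F₂ (Ψ.functor.map ε) h₂ ∈ (e A 𝔭).carrier)
    {A A' : C} (γ : A ⟶ A') (hγ : IsPreStep F γ)
    (𝔭 : Primes (Φ.obj (op (baseObj F A)))) (𝔭' : Primes (Φ.obj (op (baseObj F A'))))
    {p' : Φ.obj (op (baseObj F A'))} (hp' : p' ∈ 𝔭'.carrier) (hpp' : pull Φ (Base F γ) p' ∈ 𝔭.carrier)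
    (hnd : ∀ d ∈ 𝔭'.carrier, ¬ d ∣ invDiv F γ hγ.2) :
    ∃ q' ∈ (e A' 𝔭').carrier, pull Φ₂ (Base F₂ (Ψ.functor.map γ)) q' ∈ (e A 𝔭).carrier := by
  have hP := hF.isPreFrobenioid
  have hP₂ := hF₂.isPreFrobenioid
  haveI : IsIso (Base F γ) := hγ.2
  -- a `𝔭'`-primary step `ε : E → A'`, co-primary with `γ`
  obtain ⟨E, ε, hεp, hεx⟩ := exists_isPrimaryPreStep_invDiv_mem hF A' 𝔭'
  have hε : IsPreStep F ε := hεp.1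
  have hdvd : ∀ x : Φ.obj (op (baseObj F A')), x ∣ invDiv F ε hε.2 → x ∣ invDiv F γ hγ.2 → x = 1 := by
    intro x hxε hxγ
    by_contra hx
    exact hnd x (Primes.mem_carrier_of_dvd 𝔭' hεx hx hxε) hxγ
  -- the cartesian square of Prop. 4.1 (iii) in `C₁`
  obtain ⟨U, ε', ι', hε', hι', hsq, -, -, hdivι', -⟩ := exists_coprimary_square hF histr hε hγ
    (fun c hcε hcγ => (hpf (baseObj F A')).mul_dvd_of_forall_common_dvd_eq_one
      (isPerfect_divisorMonoid hF hperf A') hdvd hcε hcγ)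
  have hxι' : invDiv F ι' hι'.2 = pull Φ (Base F γ) (invDiv F ε hε.2) :=
    invDiv_eq_pull_of_square hε.2 hι'.2 hdivι'
  -- `ι'` is a `𝔭`-primary step into `A`
  obtain ⟨eγ, heγ⟩ := exists_mulEquiv_pull (Φ := Φ) (Base F γ)
  have hxι'𝔭 : invDiv F ι' hι'.2 ∈ 𝔭.carrier := by
    rw [hxι', ← heγ]
    exact Primes.map_mem_carrier_of_mem eγ hp' (by rw [heγ]; exact hpp') hεx
  have hι'p : IsPrimaryPreStep F ι' := isPrimaryPreStep_of_isPrimary_invDiv hι' hxι'𝔭.1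
  -- images in `C₂`
  have hΨε : IsPreStep F₂ (Ψ.functor.map ε) := hpre ε hε
  have hΨγ : IsPreStep F₂ (Ψ.functor.map γ) := hpre γ hγ
  have hΨι' : IsPreStep F₂ (Ψ.functor.map ι') := hpre ι' hι'
  haveI : IsIso (Base F₂ (Ψ.functor.map γ)) := hΨγ.2
  have hxΨε : invDiv F₂ (Ψ.functor.map ε) hΨε.2 ∈ (e A' 𝔭').carrier := he A' ε hεp 𝔭' hεx hΨε.2
  have hxΨι' : invDiv F₂ (Ψ.functor.map ι') hΨι'.2 ∈ (e A 𝔭).carrier := he A ι' hι'p 𝔭 hxι'𝔭 hΨι'.2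
  -- co-primality is categorical: `Ψ ε`, `Ψ γ` are co-primary, so Prop. 4.1 (iii) applies in `C₂`
  have hcop : ∀ ⦃Z : C⦄ (ζ : Z ⟶ A'), IsPreStep F ζ →
      (∃ (a : E ⟶ Z) (b : A ⟶ Z), IsPreStep F a ∧ IsPreStep F b ∧ a ≫ ζ = ε ∧ b ≫ ζ = γ) → IsIso ζ :=
    (isCoprimary_iff_forall_dvd hF histr hε hγ).mpr hdvd
  have hcop₂ := (coprimary_map_iff (F := F) (F₂ := F₂) Ψ hpre hpre' ε γ).mpr hcop
  have hdvd₂ := (isCoprimary_iff_forall_dvd hF₂ histr₂ hΨε hΨγ).mp hcop₂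
  obtain ⟨U₂, ε₂', ι₂', -, hι₂', -, huniv₂, -, hdivι₂', -⟩ := exists_coprimary_square hF₂ histr₂ hΨε hΨγ
    (fun c hcε hcγ => (hpf₂ (baseObj F₂ (Ψ.functor.obj A'))).mul_dvd_of_forall_common_dvd_eq_one
      (isPerfect_divisorMonoid hF₂ hperf₂ (Ψ.functor.obj A')) hdvd₂ hcε hcγ)
  have hxι₂' : invDiv F₂ ι₂' hι₂'.2 = pull Φ₂ (Base F₂ (Ψ.functor.map γ)) (invDiv F₂ (Ψ.functor.map ε) hΨε.2) :=
    invDiv_eq_pull_of_square hΨε.2 hι₂'.2 hdivι₂'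
  -- the mediating pre-step `u : Ψ U → U₂` of the image square
  obtain ⟨u, ⟨-, hu⟩, -⟩ := huniv₂ (Ψ.functor.map ε') (Ψ.functor.map ι') (hpre ε' hε') hΨι'
    (by rw [← Functor.map_comp, hsq, Functor.map_comp])
  have hcomp : IsBaseIso F₂ (u ≫ ι₂') := by rw [hu]; exact hΨι'.2
  have hdvd' : invDiv F₂ ι₂' hι₂'.2 ∣ invDiv F₂ (Ψ.functor.map ι') hΨι'.2 := by
    have h := invDiv_dvd_invDiv_comp u ι₂' hι₂' hcomp
    rwa [RatFrac.invDiv_congr F₂ hu hcomp hΨι'.2] at h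
  -- `x_{ι₂'} ≠ 1` divides the primary `x_{Ψ ι'} ∈ e_A 𝔭`, hence lies in `e_A 𝔭`
  have hne : invDiv F₂ ι₂' hι₂'.2 ≠ 1 := by
    rw [hxι₂']
    exact pull_ne_one_of_ne_one _ hxΨε.1.1
  refine ⟨invDiv F₂ (Ψ.functor.map ε) hΨε.2, hxΨε, ?_⟩
  rw [← hxι₂']
  exact Primes.mem_carrier_of_dvd _ hxΨι' hne hdvd'

/-- **The same-prime case** ("the vertical morphisms and composite morphisms of the upper square are
either isomorphisms or primary steps", p. 80 l. 50): for a pre-step `γ : A → A'` with `x_γ ∈ 𝔭'` and primes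
`𝔭 ∋ Φ₁(Base γ)(p')`, `p' ∈ 𝔭'`, there is `q' ∈ e_{A'} 𝔭'` with `Φ₂(Base Ψγ)(q') ∈ e_A 𝔭`: for a
`𝔭`-primary `ε₀` into `A` the composite `ε₀ ≫ γ` is a `𝔭'`-primary step into `A'`, and `γ_*(x_{Ψ ε₀})`
is a non-trivial divisor of `x_{Ψ(ε₀ ≫ γ)}`. [cite: MochizukiFrdI2008, Thm. 4.2 (ii) p.80] -/
theorem primes_compat_preStep_of_mem (hF : IsFrobenioid F) (hF₂ : IsFrobenioid F₂)
    (hpre : ∀ ⦃X Y : C⦄ (φ : X ⟶ Y), IsPreStep F φ → IsPreStep F₂ (Ψ.functor.map φ))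
    (e : ∀ A : C, Primes (Φ.obj (op (baseObj F A))) ≃ Primes (Φ₂.obj (op (baseObj F₂ (Ψ.functor.obj A)))))
    (he : ∀ (A : C) ⦃E : C⦄ (ε : E ⟶ A) (hε : IsPrimaryPreStep F ε) (𝔭 : Primes (Φ.obj (op (baseObj F A)))),
      invDiv F ε hε.1.2 ∈ 𝔭.carrier → ∀ h₂ : IsBaseIso F₂ (Ψ.functor.map ε),
        invDiv F₂ (Ψ.functor.map ε) h₂ ∈ (e A 𝔭).carrier)
    {A A' : C} (γ : A ⟶ A') (hγ : IsPreStep F γ)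
    (𝔭 : Primes (Φ.obj (op (baseObj F A)))) (𝔭' : Primes (Φ.obj (op (baseObj F A'))))
    {p' : Φ.obj (op (baseObj F A'))} (hp' : p' ∈ 𝔭'.carrier) (hpp' : pull Φ (Base F γ) p' ∈ 𝔭.carrier)
    (hγx : invDiv F γ hγ.2 ∈ 𝔭'.carrier) :
    ∃ q' ∈ (e A' 𝔭').carrier, pull Φ₂ (Base F₂ (Ψ.functor.map γ)) q' ∈ (e A 𝔭).carrier := by
  have hP := hF.isPreFrobenioid
  have hP₂ := hF₂.isPreFrobenioid
  haveI : IsIso (Base F γ) := hγ.2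
  -- a `𝔭`-primary step `ε₀ : E → A`; the composite `ε₀ ≫ γ` is `𝔭'`-primary
  obtain ⟨E, ε₀, hε₀p, hε₀x⟩ := exists_isPrimaryPreStep_invDiv_mem hF A 𝔭
  have hε₀ : IsPreStep F ε₀ := hε₀p.1
  have hκ : IsPreStep F (ε₀ ≫ γ) := IsPreStep.comp F hε₀ hγ
  obtain ⟨eγ', heγ'⟩ := exists_mulEquiv_pull (Φ := Φ) (inv (Base F γ))
  have hpush : pull Φ (inv (Base F γ)) (invDiv F ε₀ hε₀.2) ∈ 𝔭'.carrier := by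
    rw [← heγ']
    refine Primes.map_mem_carrier_of_mem eγ' hpp' ?_ hε₀x
    rw [heγ', ← pull_comp, IsIso.inv_hom_id, pull_id]
    exact hp'
  have hκx : invDiv F (ε₀ ≫ γ) hκ.2 ∈ 𝔭'.carrier := by
    rw [invDiv_comp_eq_mul ε₀ γ hε₀.2 hγ hκ.2]
    exact Primes.mul_mem_carrier (hP.isDivisorial (baseObj F A')).isSharp 𝔭' hγx hpush
  have hκp : IsPrimaryPreStep F (ε₀ ≫ γ) := isPrimaryPreStep_of_isPrimary_invDiv hκ hκx.1
  -- images in `C₂`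
  have hΨε₀ : IsPreStep F₂ (Ψ.functor.map ε₀) := hpre ε₀ hε₀
  have hΨγ : IsPreStep F₂ (Ψ.functor.map γ) := hpre γ hγ
  haveI : IsIso (Base F₂ (Ψ.functor.map γ)) := hΨγ.2
  have hΨκ : IsPreStep F₂ (Ψ.functor.map ε₀ ≫ Ψ.functor.map γ) := IsPreStep.comp F₂ hΨε₀ hΨγ
  have hΨκ' : IsBaseIso F₂ (Ψ.functor.map (ε₀ ≫ γ)) := by rw [Functor.map_comp]; exact hΨκ.2
  have hxΨε₀ : invDiv F₂ (Ψ.functor.map ε₀) hΨε₀.2 ∈ (e A 𝔭).carrier := he A ε₀ hε₀p 𝔭 hε₀x hΨε₀.2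
  have hxΨκ : invDiv F₂ (Ψ.functor.map ε₀ ≫ Ψ.functor.map γ) hΨκ.2 ∈ (e A' 𝔭').carrier := by
    rw [← RatFrac.invDiv_congr F₂ (Ψ.functor.map_comp ε₀ γ) hΨκ' hΨκ.2]
    exact he A' (ε₀ ≫ γ) hκp 𝔭' hκx hΨκ'
  -- `γ_*(x_{Ψ ε₀})` is a non-trivial divisor of `x_{Ψ(ε₀ ≫ γ)}`
  have hdvd : pull Φ₂ (inv (Base F₂ (Ψ.functor.map γ))) (invDiv F₂ (Ψ.functor.map ε₀) hΨε₀.2) ∣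
      invDiv F₂ (Ψ.functor.map ε₀ ≫ Ψ.functor.map γ) hΨκ.2 := by
    rw [invDiv_comp_eq_mul (Ψ.functor.map ε₀) (Ψ.functor.map γ) hΨε₀.2 hΨγ hΨκ.2]
    exact Dvd.intro_left _ rfl
  have hne : pull Φ₂ (inv (Base F₂ (Ψ.functor.map γ))) (invDiv F₂ (Ψ.functor.map ε₀) hΨε₀.2) ≠ 1 :=
    pull_ne_one_of_ne_one _ hxΨε₀.1.1
  refine ⟨_, Primes.mem_carrier_of_dvd _ hxΨκ hne hdvd, ?_⟩
  rw [← pull_comp, IsIso.hom_inv_id, pull_id]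
  exact hxΨε₀

set_option backward.isDefEq.respectTransparency false in
/-- **Theorem 4.2 (ii), functoriality of `Ψ^Prime` with respect to pre-steps** (FrdI p. 80 l. 44 –
p. 81 l. 4), the body of `FrdI.T42.PsiPrimeFunctorialPreStep`: for Frobenioids of perfect and isotropic
type with perf-factorial divisor monoids, an equivalence `Ψ` which with `Ψ⁻¹` preserves pre-steps and
which preserves primary pre-steps, and a family `e` with the characteristic property of `Ψ^Prime`, every
PRE-STEP `γ : A → A'` satisfies: primes `𝔭 ⊆ Φ₁(A)`, `𝔭' ⊆ Φ₁(A')` corresponding under `Φ₁(Base γ)` are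
carried by `e` to primes corresponding under `Φ₂(Base (Ψ γ))`. Proof: split `x_γ = c · r` at `𝔭'`, factor
`γ = g ≫ ζ` with `x_ζ = c` (Def. 1.3 (iii)(d)), apply the co-primary case to `g` and the same-prime case to
`ζ`. [cite: MochizukiFrdI2008, Thm. 4.2 (ii) p.80] -/
theorem primesEquiv_naturality_preStep_mem (hF : IsFrobenioid F) (hF₂ : IsFrobenioid F₂)
    (hperf : IsOfPerfectType F) (hperf₂ : IsOfPerfectType F₂) (histr : IsOfIsotropicType F)
    (histr₂ : IsOfIsotropicType F₂) (hpf : Objectwise (fun M _ => IsPerfFactorial M) Φ)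
    (hpf₂ : Objectwise (fun M _ => IsPerfFactorial M) Φ₂)
    (hpre : ∀ ⦃X Y : C⦄ (φ : X ⟶ Y), IsPreStep F φ → IsPreStep F₂ (Ψ.functor.map φ))
    (hpre' : ∀ ⦃X Y : C₂⦄ (φ : X ⟶ Y), IsPreStep F₂ φ → IsPreStep F (Ψ.inverse.map φ))
    (e : ∀ A : C, Primes (Φ.obj (op (baseObj F A))) ≃ Primes (Φ₂.obj (op (baseObj F₂ (Ψ.functor.obj A)))))
    (he : ∀ (A : C) ⦃E : C⦄ (ε : E ⟶ A) (hε : IsPrimaryPreStep F ε) (𝔭 : Primes (Φ.obj (op (baseObj F A)))),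
      invDiv F ε hε.1.2 ∈ 𝔭.carrier → ∀ h₂ : IsBaseIso F₂ (Ψ.functor.map ε),
        invDiv F₂ (Ψ.functor.map ε) h₂ ∈ (e A 𝔭).carrier)
    {A A' : C} (γ : A ⟶ A') (hγ : IsPreStep F γ)
    (𝔭 : Primes (Φ.obj (op (baseObj F A)))) (𝔭' : Primes (Φ.obj (op (baseObj F A'))))
    (hrel : ∃ p' ∈ 𝔭'.carrier, pull Φ (Base F γ) p' ∈ 𝔭.carrier) :
    ∃ q' ∈ (e A' 𝔭').carrier, pull Φ₂ (Base F₂ (Ψ.functor.map γ)) q' ∈ (e A 𝔭).carrier := by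
  have hP := hF.isPreFrobenioid
  have hP₂ := hF₂.isPreFrobenioid
  obtain ⟨p', hp', hpp'⟩ := hrel
  haveI : IsIso (Base F γ) := hγ.2
  haveI : IsCancelMul (Φ.obj (op (baseObj F A'))) :=
    isIntegral_iff_isCancelMul.mp (hP.isDivisorial (baseObj F A')).isPreDivisorial.isIntegral
  have hco : ∀ {X Y : C} (f : X ⟶ Y), IsCoAngular F f :=
    fun f => isCoAngular_of_isIsotropic_codomains F f fun Z _ => histr Z
  -- split `x_γ = c · r` at `𝔭'` and factor `γ = g ≫ ζ` with `x_ζ = c` (Def. 1.3 (iii)(d))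
  obtain ⟨c, r, hcr, hc, hr⟩ := (hpf (baseObj F A')).exists_split_at_prime
    (isPerfect_divisorMonoid hF hperf A') (invDiv F γ hγ.2) 𝔭'
  rcases hc with hc | hc
  · -- `c = 1`: no element of `𝔭'` divides `x_γ` — the co-primary case
    subst hc
    rw [one_mul] at hcr
    subst hcr
    exact primes_compat_preStep_of_forall_not_dvd Ψ hF hF₂ hperf hperf₂ histr histr₂ hpf hpf₂ hpre hpre'
      e he γ hγ 𝔭 𝔭' hp' hpp' hr
  · obtain ⟨Z, ζ, hζco, hζx⟩ := hF.iii_d_over_surj A' c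
    have hζ : IsPreStep F ζ := hζco.2
    haveI : IsIso (Base F ζ) := hζ.2
    obtain ⟨g, hgco, hgζ⟩ := hF.iii_d_over_full γ ζ ⟨hco γ, hγ⟩ hζco
      (by rw [hζx, ← hcr]; exact Dvd.intro r rfl)
    have hg : IsPreStep F g := hgco.2
    haveI : IsIso (Base F g) := hg.2
    -- `x_g = Φ(Base ζ)(r)`
    have hγ' : IsBaseIso F (g ≫ ζ) := by rw [hgζ]; exact hγ.2
    have hxg : invDiv F g hg.2 = pull Φ (Base F ζ) r := by
      have h1 : invDiv F (g ≫ ζ) hγ' = invDiv F γ hγ.2 := RatFrac.invDiv_congr F hgζ hγ' hγ.2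
      have h2 := invDiv_comp_eq_mul g ζ hg.2 hζ hγ'
      rw [h1, ← hcr, hζx] at h2
      have h3 : r = pull Φ (inv (Base F ζ)) (invDiv F g hg.2) := mul_left_cancel h2
      rw [h3, ← pull_comp, IsIso.hom_inv_id, pull_id]
    -- the prime `𝔭_Z` of `Φ(Z)` corresponding to `𝔭'` under `Base(ζ)`
    have hpZprim : IsPrimary (pull Φ (Base F ζ) p') := (isPrimary_pull_iff (Base F ζ) p').mpr hp'.1
    let 𝔭Z : Primes (Φ.obj (op (baseObj F Z))) := Quotient.mk _ ⟨pull Φ (Base F ζ) p', hpZprim⟩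
    have hpZ : pull Φ (Base F ζ) p' ∈ 𝔭Z.carrier := mem_carrier_mk_of_isPrimary hpZprim
    obtain ⟨eζ, heζ⟩ := exists_mulEquiv_pull (Φ := Φ) (Base F ζ)
    obtain ⟨eζ', heζ'⟩ := exists_mulEquiv_pull (Φ := Φ) (inv (Base F ζ))
    -- no element of `𝔭_Z` divides `x_g`
    have hndg : ∀ d ∈ 𝔭Z.carrier, ¬ d ∣ invDiv F g hg.2 := by
      intro d hd hdg
      have hd' : pull Φ (inv (Base F ζ)) d ∈ 𝔭'.carrier := by
        rw [← heζ']
        refine Primes.map_mem_carrier_of_mem eζ' hpZ ?_ hd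
        rw [heζ', ← pull_comp, IsIso.inv_hom_id, pull_id]
        exact hp'
      refine hr _ hd' ?_
      have := map_dvd (pull Φ (inv (Base F ζ))) hdg
      rwa [hxg, ← pull_comp, IsIso.inv_hom_id, pull_id] at this
    -- the co-primary case for `g` with the primes `𝔭`, `𝔭_Z`
    have hppZ : pull Φ (Base F g) (pull Φ (Base F ζ) p') ∈ 𝔭.carrier := by
      rw [← pull_comp, ← base_comp, hgζ]
      exact hpp'
    obtain ⟨qZ, hqZ, hqZA⟩ := primes_compat_preStep_of_forall_not_dvd Ψ hF hF₂ hperf hperf₂ histr histr₂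
      hpf hpf₂ hpre hpre' e he g hg 𝔭 𝔭Z hpZ hppZ hndg
    -- the same-prime case for `ζ` with the primes `𝔭_Z`, `𝔭'`
    have hζx' : invDiv F ζ hζ.2 ∈ 𝔭'.carrier := by
      rw [show invDiv F ζ hζ.2 = c from hζx]
      exact hc
    obtain ⟨q', hq', hq'Z⟩ := primes_compat_preStep_of_mem Ψ hF hF₂ hpre e he ζ hζ 𝔭Z 𝔭' hp' hpZ hζx'
    -- compose along `Ψ γ = Ψ g ≫ Ψ ζ`
    refine ⟨q', hq', ?_⟩
    have hΨg : IsPreStep F₂ (Ψ.functor.map g) := hpre g hg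
    haveI : IsIso (Base F₂ (Ψ.functor.map g)) := hΨg.2
    obtain ⟨eg, heg⟩ := exists_mulEquiv_pull (Φ := Φ₂) (Base F₂ (Ψ.functor.map g))
    rw [← hgζ, Functor.map_comp, base_comp, pull_comp, ← heg]
    exact Primes.map_mem_carrier_of_mem eg hqZ (by rw [heg]; exact hqZA) hq'Z

end PreFrobenioid

end Literature.AlgebraicGeometry.Frobenioids
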